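import Summits.AtomisticToContinuum.FouriersLaw.Theorems.BondHeatUncertaintyExtensiveSnapshotIrreversibilityEnergyWindowDensityFloorB

/-!
# «EnergyWindowDensityFloor» (lens-1 g73 node J: the two halves of A3, A1⁺ proved, the seam A3i → A3p → A3, placement from (R), the first rung of A3i (response identity on Range(L_{T,T})), A3i as weighted TV linear response) — part 3 of 3 (sequel of `…BondHeatUncertaintyExtensiveSnapshotIrreversibilityEnergyWindowDensityFloorB`)

Split for the 400-line cap by the landing lane (hand-2 g30); the module docstring of part 1 (`…BondHeatUncertaintyExtensiveSnapshotIrreversibilityEnergyWindowDensityFloorA`) describes the whole node.  Same namespace; all FQNs unchanged.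
0 sorry; standard axioms.
-/

noncomputable section

namespace Summit.AtomisticToContinuum.FouriersLaw.Theorems.ExtensiveSnapshotIrreversibility.EnergyWindow

open MeasureTheory Filter Topology Real
open scoped ENNReal NNReal
open Literature.MathematicalPhysics.KineticTheory.HeatConduction
-- landing revision (as in the landed `…EnergyWindowTree` / `…EnergyWindow`): the seat namespace `Tree` of re-proved tree lemmas is gone;
-- the originals are opened instead.
open Summit.AtomisticToContinuum.FouriersLaw.Theorems.ExtensiveSnapshotIrreversibility.Negative
open Summit.AtomisticToContinuum.FouriersLaw.Theorems.ExtensiveSnapshotIrreversibility.ClausiusBudget.OddLogDensity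

variable {N : ℕ}

/-! ## 5. The first rung of A3i: the response identity on `Range(L_{T,T})` from F's defect identity -/

/-- **Defect form of the steady-state equation**: for `C¹` potentials, every weak steady state `ν`
at `(T+δ/2, T−δ/2)` and every `f ∈ C_c^∞`,
`∫ L_{T,T} f dν = −(γδ/2) ∫ D f dν`, `D f = ∂²_{p_0} f − ∂²_{p_{N−1}} f`
(split the integral of `integral_generator_add_defect_eq_zero`; both summands are integrable since
`(γδ/2) D f = L_{T+δ/2,T−δ/2} f − L_{T,T} f`). [folklore] -/
theorem integral_generator_eq_neg_defect (P : OscillatorChain) (hUc : ContDiff ℝ 1 P.U)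
    (hVc : ContDiff ℝ 1 P.V) {N : ℕ} {T δ : ℝ} {ν : Measure (PhaseSpace N)}
    (hν : P.IsSteadyState N (T + δ / 2) (T - δ / 2) ν) {f : PhaseSpace N → ℝ}
    (hf : ContDiff ℝ ((⊤ : ℕ∞) : WithTop ℕ∞) f) (hfc : HasCompactSupport f) :
    ∫ x, P.generator N T T f x ∂ν = -(P.γ * (δ / 2)) *
      ∫ x, (∑ i : Fin N, ((if i.val = 0 then partialP i (partialP i f) x else 0) -
        (if i.val = N - 1 then partialP i (partialP i f) x else 0))) ∂ν := by
  haveI : IsProbabilityMeasure ν := hν.1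
  have hf2 : ContDiff ℝ 2 f := hf.of_le (by norm_cast)
  have h0 := integral_generator_add_defect_eq_zero P hν hf hfc
  have hiT : Integrable (P.generator N T T f) ν := P.integrable_generator hUc hVc N T T hf2 hfc ν
  have hiδ : Integrable (P.generator N (T + δ / 2) (T - δ / 2) f) ν :=
    P.integrable_generator hUc hVc N _ _ hf2 hfc ν
  have hiD : Integrable (fun x => P.γ * (δ / 2) *
      ∑ i : Fin N, ((if i.val = 0 then partialP i (partialP i f) x else 0) -
        (if i.val = N - 1 then partialP i (partialP i f) x else 0))) ν := by
    refine (hiδ.sub hiT).congr (ae_of_all _ fun x => ?_)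
    simp only [Pi.sub_apply]
    rw [generator_window_eq P N T δ f x]
    ring
  have h1 : ∫ x, P.generator N T T f x ∂ν + ∫ x, (P.γ * (δ / 2) *
      ∑ i : Fin N, ((if i.val = 0 then partialP i (partialP i f) x else 0) -
        (if i.val = N - 1 then partialP i (partialP i f) x else 0))) ∂ν = 0 := by
    rw [← integral_add hiT hiD]
    exact h0
  rw [integral_const_mul] at h1
  linarith

/-- **The response identity on `Range(L_{T,T})` (first rung of A3i)**: for the pinned chain,
`T > 0`, every weak steady state `ν` at `(T+δ/2, T−δ/2)` and every `u ∈ C_c^∞`,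
`∫ L_{T,T} u dν − ∫ L_{T,T} u dμ_T = −(γδ/2) ∫ D u dν` — the Gibbs state annihilates `L_{T,T} u`
(`pinnedChain_isSteadyState_gibbsMeasure`).  With `g = L_{T,T} u` this is `μ_δ(g) − μ_T(g) = O(δ)`
with the explicit constant `(γ/2) sup |D u|`: A3i restricted to `g ∈ L_{T,T}(C_c^∞)`. [folklore] -/
theorem response_identity_range {ω₂ lam β γ : ℝ} (hω : 0 < ω₂) (hl : 0 ≤ lam) (hβ : 0 ≤ β)
    {N : ℕ} {T δ : ℝ} (hT : 0 < T) {ν : Measure (PhaseSpace N)}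
    (hν : (pinnedChain ω₂ lam β γ).IsSteadyState N (T + δ / 2) (T - δ / 2) ν)
    {u : PhaseSpace N → ℝ} (hu : ContDiff ℝ ((⊤ : ℕ∞) : WithTop ℕ∞) u) (huc : HasCompactSupport u) :
    ∫ x, (pinnedChain ω₂ lam β γ).generator N T T u x ∂ν -
        ∫ x, (pinnedChain ω₂ lam β γ).generator N T T u x ∂((pinnedChain ω₂ lam β γ).gibbsMeasure N T) =
      -((pinnedChain ω₂ lam β γ).γ * (δ / 2)) *
        ∫ x, (∑ i : Fin N, ((if i.val = 0 then partialP i (partialP i u) x else 0) -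
          (if i.val = N - 1 then partialP i (partialP i u) x else 0))) ∂ν := by
  have hG := (pinnedChain_isSteadyState_gibbsMeasure hω hl hβ γ N hT).2.1 u hu huc
  rw [hG, sub_zero]
  exact integral_generator_eq_neg_defect _ (pinnedChain_contDiff_U ω₂ lam β γ (n := 1))
    (pinnedChain_contDiff_V ω₂ lam β γ (n := 1)) hν hu huc

/-- **`O(δ)` bound on the range**: under the hypotheses of `response_identity_range`, if `|D u| ≤ K`
pointwise then `|∫ L_{T,T} u dν − ∫ L_{T,T} u dμ_T| ≤ (|γ| K / 2) |δ|`. [folklore] -/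
theorem abs_response_range_le {ω₂ lam β γ : ℝ} (hω : 0 < ω₂) (hl : 0 ≤ lam) (hβ : 0 ≤ β)
    {N : ℕ} {T δ : ℝ} (hT : 0 < T) {ν : Measure (PhaseSpace N)}
    (hν : (pinnedChain ω₂ lam β γ).IsSteadyState N (T + δ / 2) (T - δ / 2) ν)
    {u : PhaseSpace N → ℝ} (hu : ContDiff ℝ ((⊤ : ℕ∞) : WithTop ℕ∞) u) (huc : HasCompactSupport u)
    {K : ℝ} (hK : ∀ x, |∑ i : Fin N, ((if i.val = 0 then partialP i (partialP i u) x else 0) -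
      (if i.val = N - 1 then partialP i (partialP i u) x else 0))| ≤ K) :
    |∫ x, (pinnedChain ω₂ lam β γ).generator N T T u x ∂ν -
        ∫ x, (pinnedChain ω₂ lam β γ).generator N T T u x ∂((pinnedChain ω₂ lam β γ).gibbsMeasure N T)| ≤
      |γ| * K / 2 * |δ| := by
  haveI : IsProbabilityMeasure ν := hν.1
  have hγ' : (pinnedChain ω₂ lam β γ).γ = γ := rfl
  rw [response_identity_range hω hl hβ hT hν hu huc, abs_mul, abs_neg, abs_mul, hγ', abs_div,
    abs_two]
  have hI : |∫ x, (∑ i : Fin N, ((if i.val = 0 then partialP i (partialP i u) x else 0) -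
      (if i.val = N - 1 then partialP i (partialP i u) x else 0))) ∂ν| ≤ K := by
    refine (abs_integral_le_integral_abs).trans ?_
    calc ∫ x, |∑ i : Fin N, ((if i.val = 0 then partialP i (partialP i u) x else 0) -
          (if i.val = N - 1 then partialP i (partialP i u) x else 0))| ∂ν
        ≤ ∫ x, K ∂ν := integral_mono_of_nonneg (ae_of_all _ fun x => abs_nonneg _)
            (integrable_const K) (ae_of_all _ hK)
      _ = K := by simp
  have hK0 : 0 ≤ K := (abs_nonneg _).trans (hK 0)
  calc |γ| * (|δ| / 2) * |∫ x, (∑ i : Fin N, ((if i.val = 0 then partialP i (partialP i u) x else 0) -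
        (if i.val = N - 1 then partialP i (partialP i u) x else 0))) ∂ν|
      ≤ |γ| * (|δ| / 2) * K := mul_le_mul_of_nonneg_left hI (by positivity)
    _ = |γ| * K / 2 * |δ| := by ring

/-! ## 6. The junction through the split -/

/-- **Glue `A0 → A2 → A3i → A3p → A4 → (W)`** (A1 is proved; A3 from the seam). [folklore] -/
theorem energyWindowControl_of_atoms₅ (h0 : NessGibbsReweighting) (h2 : NessOddLogRatioBound)
    (h3i : NessWeightedL1Response) (h3p : NessFloorMeanValue) (h4 : NessLinearResponseL2) :
    EnergyWindowControl :=
  energyWindowControl_of_atoms₄ h0 h2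
    (nessDensityFloor_of_weightedL1Response_of_floorMeanValue h3i h3p) h4

/-- ★ **The junction `K_fix ⟸ A0 ∧ A2 ∧ A3i ∧ A3p ∧ A4`.** [folklore] -/
theorem snapshotKLUpperExpansion_of_atoms₅ (h0 : NessGibbsReweighting) (h2 : NessOddLogRatioBound)
    (h3i : NessWeightedL1Response) (h3p : NessFloorMeanValue) (h4 : NessLinearResponseL2) :
    SnapshotKLUpperExpansion :=
  snapshotKLUpperExpansion_of_atoms₄ h0 h2
    (nessDensityFloor_of_weightedL1Response_of_floorMeanValue h3i h3p) h4

/-! ## 7. A3i is weighted total-variation linear response (representative-free form) -/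

/-- **A3i, representative-free (`NessWeightedTVResponse`)**: along every steady-state family of the
pinned chain (under weak-NESS uniqueness), for `T > 0`, `N ≥ 2` and every `0 < θ < 1/T` there are
`δ₀ > 0`, `C` such that for `0 < |δ| < δ₀`: `e^{θH} ∈ L¹(μ_{N,T+δ/2,T−δ/2})` and
`|∫ g dμ_{N,T+δ/2,T−δ/2} − ∫ g dμ_T| ≤ C|δ|` for EVERY measurable `g` with `|g| ≤ e^{θH}` — Lipschitz
continuity at `δ = 0` of the NESS in the `e^{θH}`-weighted total-variation norm: exactly the
conclusion of the Hairer–Majda linear-response framework (weighted norms) for this family.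
Equivalent to A3i given A0 (`nessWeightedTVResponse_of_weightedL1Response`,
`nessWeightedL1Response_of_weightedTVResponse`). [route statement · this cell; NOT a literature fact] -/
def NessWeightedTVResponse : Prop :=
  ∀ ω₂ lam β γ : ℝ, 0 < ω₂ → 0 < lam → 0 < β → 0 < γ →
    (∀ (N : ℕ) (T_L T_R : ℝ), 0 < T_L → 0 < T_R → ∀ μ ν : Measure (PhaseSpace N),
      (pinnedChain ω₂ lam β γ).IsSteadyState N T_L T_R μ →
      (pinnedChain ω₂ lam β γ).IsSteadyState N T_L T_R ν → μ = ν) →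
    ∀ μ : (N : ℕ) → ℝ → ℝ → Measure (PhaseSpace N),
      (∀ (N : ℕ) (T_L T_R : ℝ), 0 < T_L → 0 < T_R →
        (pinnedChain ω₂ lam β γ).IsSteadyState N T_L T_R (μ N T_L T_R)) →
      ∀ T : ℝ, 0 < T → ∀ N : ℕ, 2 ≤ N → ∀ θ : ℝ, 0 < θ → θ < 1 / T →
        ∃ δ₀ C : ℝ, 0 < δ₀ ∧
          ∀ δ : ℝ, δ ≠ 0 → |δ| < δ₀ →
            Integrable (fun x => Real.exp (θ * (pinnedChain ω₂ lam β γ).hamiltonian N x))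
                (μ N (T + δ / 2) (T - δ / 2)) ∧
              ∀ g : PhaseSpace N → ℝ, Measurable g →
                (∀ x, |g x| ≤ Real.exp (θ * (pinnedChain ω₂ lam β γ).hamiltonian N x)) →
                |∫ x, g x ∂(μ N (T + δ / 2) (T - δ / 2)) -
                    ∫ x, g x ∂((pinnedChain ω₂ lam β γ).gibbsMeasure N T)| ≤ C * |δ|

/-- **A0 ∧ A3i ⟹ the representative-free form**: `∫ g dμ_δ − ∫ g dμ_T = ∫ (e^{φ_δ} − 1) g dμ_T`
and `|(e^{φ_δ} − 1) g| ≤ e^{θH}|e^{φ_δ} − 1|`; `e^{θH} ∈ L¹(μ_δ)` because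
`e^{φ_δ} e^{θH} = e^{θH}(e^{φ_δ} − 1) + e^{θH}` is `μ_T`-integrable. [folklore] -/
theorem nessWeightedTVResponse_of_weightedL1Response (h0 : NessGibbsReweighting)
    (hi : NessWeightedL1Response) : NessWeightedTVResponse := by
  intro ω₂ lam β γ hω hl hβ hγ hU μ hμ T hT N hN θ hθ hθ1
  obtain ⟨φ, hφm, hW0⟩ := h0 ω₂ lam β γ hω hl hβ hγ hU μ hμ T hT N hN
  obtain ⟨δ₁, C, hδ₁, h1⟩ := hi ω₂ lam β γ hω hl hβ hγ hU μ hμ T hT N hN θ hθ hθ1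
  have hIθ : Integrable (fun x => exp (θ * (pinnedChain ω₂ lam β γ).hamiltonian N x))
      ((pinnedChain ω₂ lam β γ).gibbsMeasure N T) :=
    pinnedChain_integrable_exp_mul_hamiltonian_gibbsMeasure hω hl.le hβ.le γ N hT hθ1
  set P := pinnedChain ω₂ lam β γ with hP
  set μT := P.gibbsMeasure N T with hμT
  haveI : IsProbabilityMeasure μT :=
    pinnedChain_isProbabilityMeasure_gibbsMeasure hω hl.le hβ.le γ N hT
  refine ⟨min δ₁ T, C, lt_min hδ₁ hT, fun δ hδ hδ' => ?_⟩
  have hδ1' : |δ| < δ₁ := hδ'.trans_le (min_le_left _ _)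
  have hδT : |δ| < T := hδ'.trans_le (min_le_right _ _)
  have hTL : 0 < T + δ / 2 := by linarith [neg_abs_le δ]
  have hTR : 0 < T - δ / 2 := by linarith [le_abs_self δ]
  haveI : IsProbabilityMeasure (μ N (T + δ / 2) (T - δ / 2)) := (hμ N _ _ hTL hTR).1
  have hrep := hW0 δ (by linarith)
  obtain ⟨hint, hI⟩ := h1 δ hδ hδ1' (φ δ) (hφm δ) hrep
  obtain ⟨hiφ, hz1, htilt⟩ := tilted_of_withDensity_exp (hφm δ) hrep
  have hprod : Integrable (fun x => exp (φ δ x) * exp (θ * P.hamiltonian N x)) μT := by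
    refine (hint.add hIθ).congr (ae_of_all _ fun x => ?_)
    simp only [Pi.add_apply]
    ring
  have hintabs : Integrable (fun x => exp (θ * P.hamiltonian N x) * |exp (φ δ x) - 1|) μT := by
    refine hint.abs.congr (ae_of_all _ fun x => ?_)
    simp only [abs_mul, abs_of_pos (exp_pos _)]
  refine ⟨?_, fun g hgm hg => ?_⟩
  · rw [htilt, integrable_tilted_iff hiφ]
    exact hprod.congr (ae_of_all _ fun x => by simp only [smul_eq_mul])
  · have hgi : Integrable g μT :=
      hIθ.mono' hgm.aestronglyMeasurable (ae_of_all _ fun x => by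
        rw [Real.norm_eq_abs]; exact hg x)
    have hφg : Integrable (fun x => exp (φ δ x) * g x) μT :=
      hprod.mono' ((hφm δ).exp.mul hgm).aestronglyMeasurable (ae_of_all _ fun x => by
        rw [Real.norm_eq_abs, abs_mul, abs_of_pos (exp_pos _)]
        exact mul_le_mul_of_nonneg_left (hg x) (exp_pos _).le)
    have hμδg : ∫ x, g x ∂(μ N (T + δ / 2) (T - δ / 2)) = ∫ x, exp (φ δ x) * g x ∂μT := by
      rw [htilt, integral_tilted]
      refine integral_congr_ae (ae_of_all _ fun x => ?_)
      simp only [hz1, div_one, smul_eq_mul]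
    rw [hμδg, ← integral_sub hφg hgi]
    calc |∫ x, (exp (φ δ x) * g x - g x) ∂μT|
        ≤ ∫ x, |exp (φ δ x) * g x - g x| ∂μT := abs_integral_le_integral_abs
      _ ≤ ∫ x, exp (θ * P.hamiltonian N x) * |exp (φ δ x) - 1| ∂μT := by
          refine integral_mono_of_nonneg (ae_of_all _ fun x => abs_nonneg _) hintabs
            (ae_of_all _ fun x => ?_)
          show |exp (φ δ x) * g x - g x| ≤ exp (θ * P.hamiltonian N x) * |exp (φ δ x) - 1|
          have e : exp (φ δ x) * g x - g x = (exp (φ δ x) - 1) * g x := by ring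
          rw [e, abs_mul, mul_comm]
          exact mul_le_mul_of_nonneg_right (hg x) (abs_nonneg _)
      _ ≤ C * |δ| := hI

/-- **The representative-free form ⟹ A3i**: test against `g = e^{θH} sign(e^{φ} − 1)`, for which
`∫ g dμ_δ − ∫ g dμ_T = ∫ e^{θH}|e^{φ} − 1| dμ_T`; integrability from `e^{θH} ∈ L¹(μ_δ)` pulled
back to `μ_T` by the tilted representation. [folklore] -/
theorem nessWeightedL1Response_of_weightedTVResponse (h : NessWeightedTVResponse) :
    NessWeightedL1Response := by
  intro ω₂ lam β γ hω hl hβ hγ hU μ hμ T hT N hN θ hθ hθ1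
  obtain ⟨δ₀, C, hδ₀, h1⟩ := h ω₂ lam β γ hω hl hβ hγ hU μ hμ T hT N hN θ hθ hθ1
  have hIθ : Integrable (fun x => exp (θ * (pinnedChain ω₂ lam β γ).hamiltonian N x))
      ((pinnedChain ω₂ lam β γ).gibbsMeasure N T) :=
    pinnedChain_integrable_exp_mul_hamiltonian_gibbsMeasure hω hl.le hβ.le γ N hT hθ1
  have hHm : Measurable ((pinnedChain ω₂ lam β γ).hamiltonian N) :=
    (pinnedChain_continuous_hamiltonian ω₂ lam β γ N).measurable
  set P := pinnedChain ω₂ lam β γ with hP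
  set μT := P.gibbsMeasure N T with hμT
  haveI : IsProbabilityMeasure μT :=
    pinnedChain_isProbabilityMeasure_gibbsMeasure hω hl.le hβ.le γ N hT
  refine ⟨min δ₀ T, C, lt_min hδ₀ hT, fun δ hδ hδ' ψ hψm hψ => ?_⟩
  have hδ0' : |δ| < δ₀ := hδ'.trans_le (min_le_left _ _)
  have hδT : |δ| < T := hδ'.trans_le (min_le_right _ _)
  have hTL : 0 < T + δ / 2 := by linarith [neg_abs_le δ]
  have hTR : 0 < T - δ / 2 := by linarith [le_abs_self δ]
  haveI : IsProbabilityMeasure (μ N (T + δ / 2) (T - δ / 2)) := (hμ N _ _ hTL hTR).1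
  obtain ⟨hintδ, hg⟩ := h1 δ hδ hδ0'
  obtain ⟨hiψ, hz1, htilt⟩ := tilted_of_withDensity_exp hψm hψ
  have hprod : Integrable (fun x => exp (ψ x) * exp (θ * P.hamiltonian N x)) μT := by
    rw [htilt, integrable_tilted_iff hiψ] at hintδ
    exact hintδ.congr (ae_of_all _ fun x => by simp only [smul_eq_mul])
  have hint : Integrable (fun x => exp (θ * P.hamiltonian N x) * (exp (ψ x) - 1)) μT := by
    refine (hprod.sub hIθ).congr (ae_of_all _ fun x => ?_)
    simp only [Pi.sub_apply]
    ring
  refine ⟨hint, ?_⟩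
  -- the test function `g = e^{θH} s`, `s = sign (e^{ψ} − 1)`
  set s : PhaseSpace N → ℝ := fun x => if 0 ≤ exp (ψ x) - 1 then 1 else -1 with hs
  have hsm : Measurable s :=
    Measurable.ite (measurableSet_le measurable_const (hψm.exp.sub measurable_const))
      measurable_const measurable_const
  have hs_abs : ∀ x, s x * (exp (ψ x) - 1) = |exp (ψ x) - 1| := by
    intro x
    simp only [hs]
    split_ifs with hx
    · rw [abs_of_nonneg hx, one_mul]
    · rw [abs_of_neg (not_le.1 hx)]
      ring
  have hs1 : ∀ x, |s x| = 1 := by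
    intro x
    simp only [hs]
    split_ifs <;> simp
  set g : PhaseSpace N → ℝ := fun x => exp (θ * P.hamiltonian N x) * s x with hgdef
  have hgm : Measurable g := (hHm.const_mul θ).exp.mul hsm
  have hgb : ∀ x, |g x| ≤ exp (θ * P.hamiltonian N x) := fun x => by
    rw [hgdef, abs_mul, abs_of_pos (exp_pos _), hs1, mul_one]
  have hbound := hg g hgm hgb
  have hgi : Integrable g μT :=
    hIθ.mono' hgm.aestronglyMeasurable (ae_of_all _ fun x => by
      rw [Real.norm_eq_abs]; exact hgb x)
  have hψg : Integrable (fun x => exp (ψ x) * g x) μT :=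
    hprod.mono' (hψm.exp.mul hgm).aestronglyMeasurable (ae_of_all _ fun x => by
      rw [Real.norm_eq_abs, abs_mul, abs_of_pos (exp_pos _)]
      exact mul_le_mul_of_nonneg_left (hgb x) (exp_pos _).le)
  have hμδg : ∫ x, g x ∂(μ N (T + δ / 2) (T - δ / 2)) = ∫ x, exp (ψ x) * g x ∂μT := by
    rw [htilt, integral_tilted]
    refine integral_congr_ae (ae_of_all _ fun x => ?_)
    simp only [hz1, div_one, smul_eq_mul]
  have hdiff : ∫ x, g x ∂(μ N (T + δ / 2) (T - δ / 2)) - ∫ x, g x ∂μT =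
      ∫ x, exp (θ * P.hamiltonian N x) * |exp (ψ x) - 1| ∂μT := by
    rw [hμδg, ← integral_sub hψg hgi]
    refine integral_congr_ae (ae_of_all _ fun x => ?_)
    show exp (ψ x) * (exp (θ * P.hamiltonian N x) * s x) - exp (θ * P.hamiltonian N x) * s x =
      exp (θ * P.hamiltonian N x) * |exp (ψ x) - 1|
    rw [← hs_abs x]
    ring
  rw [hdiff] at hbound
  exact (le_abs_self _).trans hbound

end Summit.AtomisticToContinuum.FouriersLaw.Theorems.ExtensiveSnapshotIrreversibility.EnergyWindow

end
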